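import Summits.Ventures.HodgeRepro.Night3LatticeEngine
import Summits.Ventures.HodgeRepro.Night3FacePieces

/-!
# «S4-faces ⟹ S4» for `m ≤ 8` places, with Lemma L from the engine certificate

Blind re-derivation cell `pub-hodge-repro`, seat `night-3`.  Imports night-3's `Night3LatticeEngine` (the `decide +kernel`
index-one certificate, `Engine.index_one_le_eight`) and `Night3FacePieces` (the conditional closure principle
`alg_of_faces_of_spanEq`).  Namespace `HodgeRepro.Night3`.

`alg_of_faces_le_eight`: for a CM field with `m ≤ 8` infinite places (degree ≤ 16 — every degree of the sealed census (a) and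
of ROUTE.md §3.2–§3.5), every predicate `Alg` on multisets of CM types satisfying product closure and cancellation on zero-sum
multisets (Lemma P (1) / (2)–(3)) and true on the conjugate pairs (Lefschetz (1,1)) and on the census faces (S4 on the faces)
is true on every zero-sum multiset — UNCONDITIONALLY on Lemma L, which the kernel certificate supplies.  Nothing here closes S4;
no sealed file is touched; no Tier-2 item depends on this file.
-/

set_option autoImplicit false

namespace HodgeRepro.Night3

open HodgeRepro.FaceLattice

variable {m : ℕ}

/-- **«S4-faces ⟹ S4» for `m ≤ 8` places, Lemma L by the engine certificate** (`Engine.index_one_le_eight`): with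
`hadd` / `hcancel` = Lemma P (1) / (2)–(3), `hpair` = Lefschetz (1,1), `hface` = S4 on the census faces, `Alg` holds on every
zero-sum multiset of CM types. -/
theorem alg_of_faces_le_eight (h1 : 1 ≤ m) (h8 : m ≤ 8) (Alg : Multiset (CMType m) → Prop)
    (hadd : ∀ M N, IsZeroSum M → IsZeroSum N → Alg M → Alg N → Alg (M + N))
    (hcancel : ∀ M N, IsZeroSum M → IsZeroSum N → Alg (M + N) → Alg N → Alg M)
    (hpair : ∀ T, Alg (pairMul T))
    (hface : ∀ Φ p p', p ≠ p' → Alg (faceMul Φ p p'))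
    (M : Multiset (CMType m)) (hM : IsZeroSum M) : Alg M :=
  alg_of_faces_of_spanEq (Engine.index_one_le_eight m h1 h8) Alg hadd hcancel hpair hface M hM

/-- The Consequence of Lemma L in multiset form for `m ≤ 8`, Lemma L by the engine certificate. -/
theorem exists_pieces_add_pieces_le_eight (h1 : 1 ≤ m) (h8 : m ≤ 8) {M : Multiset (CMType m)} (hM : IsZeroSum M) :
    ∃ N : Multiset (CMType m), Abstract.IsPieceSum (pieces m) N ∧ Abstract.IsPieceSum (pieces m) (M + N) :=
  exists_pieces_add_pieces_of_spanEq (Engine.index_one_le_eight m h1 h8) hM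

end HodgeRepro.Night3
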